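/-
Copyright (c) 2026. Released under Apache 2.0 license.
Literature formalization: R. Kannan, A. K. Lenstra, L. Lovász, *Polynomial factorization and
nonrandomness of bits of algebraic and some transcendental numbers*, Math. Comp. 50 (1988), §1.
-/
import Mathlib
import HarnessLib
import Literature.Algebra.Polynomial.MignotteBound
import Literature.LinearAlgebra.Matrix.HadamardInequality

/-!
# The minimal polynomial of an algebraic number from an approximation (Kannan–Lenstra–Lovász)

Source: R. Kannan, A. K. Lenstra, L. Lovász, *Polynomial factorization and nonrandomness of bits
of algebraic and some transcendental numbers*, Mathematics of Computation **50** (1988), 235–250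
[cite: KannanLenstraLovasz1988], Section 1 "The minimal polynomial of an approximated algebraic
number": Lemma (1.5), Proposition (1.6), the correspondence (1.3)–(1.4), Lemma (1.9) with
(1.10)–(1.13), and Theorem (1.15) (held copy `paper:doi-10-1090-s0025-5718-1988-0917831-4`,
pp. 236–240; the displayed formulas were read from the typeset copy
`galaxy:pdf:-3413447418971467260`, chunks p0002–p0007).  Proposition (1.6) is restated as
Lemma 3.2 of Qin, Feng, Chen, Zhang, arXiv:1001.0649 (held, chunk p0006).

## The printed statements (verbatim)

(p. 236) "The length `|p|` of `p(X) = ∑_{i=0}^d pᵢ Xⁱ` is the Euclidean length of the vector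
`(p₀, p₁, …, p_d)`; the height `|p|_∞` of `p(X)` is the `L_∞`-norm of the vector
`(p₀, p₁, …, p_d)`, so `|p|_∞ = max_{0≤i≤d} |pᵢ|`. An algebraic number is a root of a polynomial
with integral coefficients. The minimal polynomial of an algebraic number `α` is the irreducible
polynomial in `ℤ[X]` satisfied by `α`. The minimal polynomial is unique up to units in `ℤ` … The
degree and height of an algebraic number are the degree and height, respectively, of its minimal
polynomial."  (p. 237) "For a polynomial `g = ∑ᵢ gᵢ Xⁱ ∈ ℂ[X]` we introduce the following
notation for the approximated evaluation of `g` at `α`: `g_ᾱ = ∑ᵢ gᵢ ᾱᵢ`."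

**(1.3)–(1.4)** (p. 237). "With `n` fixed, we define for each positive integer `s` the lattice
`L_s` in `ℝ^{n+3}` generated by `b₀, b₁, …, bₙ`, which are the rows (in order) of the following
`(n+1) × (n+3)` matrix: (1.3) [row `i`: `eᵢ` followed by `2^s · Re(ᾱᵢ)`, `2^s · Im(ᾱᵢ)`].
Corresponding to a polynomial `g = ∑_{i=0}^n gᵢ Xⁱ` in `ℤ[X]` of degree at most `n` … we have a
vector `g̃` in the lattice `L_s` defined by (1.4) `g̃ = ∑_{i=0}^n gᵢ bᵢ`. Clearly,
`|g̃|² = g₀² + g₁² + ⋯ + gₙ² + 2^{2s} (Re ∑ gᵢ ᾱᵢ)² + 2^{2s} (Im ∑ gᵢ ᾱᵢ)² = |g|² + 2^{2s} |g_ᾱ|²`."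

**(1.5) Lemma.** "If `α` and `ᾱᵢ` for `0 ≤ i ≤ n` are complex numbers such that `ᾱ₀ = 1`, and
`|αⁱ - ᾱᵢ| ≤ ε` for `1 ≤ i ≤ n` and `f` is a polynomial of degree at most `n` in `ℂ[X]`, then
`|f(α) - f_ᾱ| ≤ ε · n · |f|_∞`.  Proof. Immediate."

**(1.6) Proposition.** "Let `h` and `g` be nonzero polynomials in `ℤ[X]` of degrees `n` and
`m`, respectively, and let `α ∈ ℂ` be a zero of `h` with `|α| ≤ 1`. If `h` is irreducible and
`g(α) ≠ 0` then `|g(α)| ≥ n⁻¹ · |h|^{-m} · |g|^{-n+1}`."  Printed proof (pp. 238–239): "`n ≥ 1`.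
If `m = 0`, then `g(α) = |g|` … Now assume that `m ≠ 0`. Define the `(n+m) × (n+m)` matrix `M`
as the matrix having `i`th column `X^{i-1} · h` for `1 ≤ i ≤ m`, and `X^{i-m-1} · g` for
`m+1 ≤ i ≤ n+m` … By `R` we denote the absolute value of the determinant of `M`, the so-called
resultant of `h` and `g`. … `gcd(h, g) = 1` … `R ≠ 0`. Because the entries of `M` are
integral, we even have `R ≥ 1`. We add, for `2 ≤ i ≤ n+m`, the `i`th row of `M` times `T^{i-1}`
to the first row of `M` … Expanding … (1.7) `R = |g(α)| · |b₀ + b₁ α + ⋯ + b_{n-1} α^{n-1}|`,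
because `h(α) = 0`. From Hadamard's inequality it follows that `|bⱼ| ≤ |h|^m · |g|^{n-1}`.
Combining this with `|α| ≤ 1` we get `|b₀ + ⋯ + b_{n-1} α^{n-1}| ≤ n · |h|^m · |g|^{n-1}`, so
that (1.6) follows from (1.7) and `R ≥ 1`."

**(1.9) Lemma.** "Suppose `α` is a complex number with `|α| ≤ 1` and with minimal polynomial `h`
of degree at most `d ≥ 1` and height at most `H`, and suppose `ᾱᵢ` satisfies `ᾱ₀ = 1` and
`|αⁱ - ᾱᵢ| ≤ 2^{-s}` for `1 ≤ i ≤ d`. Let `g` be a polynomial with integral coefficients of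
degree at most `d` such that `g(α) ≠ 0`. Then with the notation introduced in (1.4), the
following inequalities hold: (1.10) `|h̃| ≤ (d+1) · H`, (1.11) `|g̃| > 2^{d/2} · (d+1) · H`,
provided (1.12) `2^s ≥ 2^{d²/2} · (d+1)^{(3d+4)/2} · H^{2d}`."  Its proof begins: "First notice
that (1.13) `|f|² ≤ (d+1) · |f|²_∞` holds for any polynomial `f` of degree at most `d`."

**(1.15) Theorem.** "Let `α, h(X), d, H`, and `ᾱᵢ ∈ 2^{-s} ℤ[√-1]`, for `0 ≤ i ≤ d`, satisfy
the hypothesis of Lemma (1.9), where `s` is such that (1.12) holds. Let `n` be an integer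
satisfying `1 ≤ n ≤ d`, and suppose that the basis reduction algorithm on input `b₀, b₁, …, bₙ`
defined in (1.3) yields a reduced basis with `ṽ = ∑_{i=0}^n vᵢ bᵢ` as the first vector. Then
the following three assertions are equivalent: (i) `|ṽ| ≤ 2^{d/2} · (d+1) · H`; (ii) `α`
satisfies the polynomial `v(X) = ∑_{i=0}^n vᵢ Xⁱ`; (iii) the degree of `α` is at most `n`.
Furthermore, if `n` equals the degree of `α`, then `h(X) = ±v(X)`."  Printed proof (p. 240):
(i) ⇒ (ii) by Lemma (1.9); (ii) ⇒ (iii) trivially; (iii) ⇒ (i): "`h̃` is a well-defined vector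
in `L_s`. Lemma (1.9) yields `|h̃| ≤ (d+1) · H`, so that … `Λ₁(L_s) ≤ (d+1) · H`. It then
follows from Theorem (1.1) that `|ṽ| ≤ 2^{d/2} · (d+1) · H`"; and "`v` is an integral multiple
of `h`. It follows that `h = ±v` because both `h̃` and `ṽ` are contained in `L_s`, and because
`ṽ` belongs to a basis for `L_s`."  Theorem (1.1) (from [16] = Lenstra–Lenstra–Lovász 1982,
Propositions (1.11) and (1.26)): "The first vector `v₁` in the reduced basis has length at most
`2^{(k-1)/2} · Λ₁(L)`, where `Λ₁(L)` is the length of a shortest nonzero vector in `L`."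

## Rendering

* `|p|` is `MignotteBound.twoNorm p` and `|p|_∞` is Mathlib's `Polynomial.supNorm p`, as in
  `Literature.Algebra.Polynomial.MignotteBound` / `CofactorResultantBound`; for `p ∈ ℤ[X]` and
  its image in `ℂ[X]` these agree (`supNorm_map_intCast`).  `g_ᾱ` is `approxEval ᾱ g` (for
  `g ∈ ℤ[X]`, applied to its image in `ℂ[X]`); `g(α)` is `Polynomial.aeval α g`.
* "`α` has minimal polynomial `h` of degree at most `d` and height at most `H`" is rendered,
  following the definition on p. 236, as: `h ∈ ℤ[X]` irreducible, `aeval α h = 0`,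
  `h.natDegree ≤ d`, `h.supNorm ≤ H`; "the degree of `α` is at most `n`" is `h.natDegree ≤ n`.
  In Proposition (1.6) the hypotheses "`h`, `g` nonzero" and "`n ≥ 1`" follow from the others
  (`h` irreducible with a root, `g(α) ≠ 0`) and are dropped; `n, m` are `h.natDegree`,
  `g.natDegree`, and the printed `n⁻¹ · |h|^{-m} · |g|^{-n+1} ≤ |g(α)|`
  (`norm_aeval_ge_inv_natDegree_mul_twoNorm_pow`) is also given in the product form
  `1 ≤ n · |h|^m · |g|^{n-1} · |g(α)|` (`one_le_natDegree_mul_twoNorm_pow_mul_norm_aeval`).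
* Half-integer powers: `2^{d/2} · (d+1) · H` enters (1.10), (1.11), (1.15)(i) only squared, as
  `2^d · ((d+1) · H)²`; (1.12) is written `√2 ^ (d²) · √(d+1) ^ (3d+4) · H ^ (2d) ≤ 2 ^ s`;
  `2^{-s}` is `(2 ^ s)⁻¹` with `s : ℕ`.
* (1.3)–(1.4): `minpolyLatticeVector s ᾱ n g : EuclideanSpace ℝ (Fin (n+3))` is the vector `g̃` with
  coordinates `(g₀, …, gₙ, 2^s Re g_ᾱ, 2^s Im g_ᾱ)`, and
  `minpolyLatticeNormSq s ᾱ g = |g|² + (2^s |g_ᾱ|)²` is the right-hand side of (1.4);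
  `norm_sq_minpolyLatticeVector` is the identity (1.4) `|g̃|² = minpolyLatticeNormSq s ᾱ g` for
  `deg g ≤ n`.  Lemma (1.9) and Theorem (1.15) are stated about `minpolyLatticeNormSq`.
* Theorem (1.15): the basis reduction algorithm (Theorem (1.1), i.e. [16]; in this library
  `Literature.Algebra.EuclideanLattices.LLLDeltaEta`) is not re-run here.  Exactly as in the
  printed proof, what is used of "`ṽ = ∑ vᵢ bᵢ` is the first vector of a reduced basis of
  `L_s = L(b₀, …, bₙ)`" is (a) `v ≠ 0`, `deg v ≤ n`, and the consequence of Theorem (1.1) with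
  `k = n + 1`: `|ṽ|² ≤ 2^n · |x̃|²` for every nonzero `x ∈ ℤ[X]` of degree at most `n` (these
  `x̃` are exactly the nonzero vectors of `L_s`, by (1.4)); and, for "`h = ±v`", (b) that `ṽ`
  belongs to a basis of `L_s`, of which the proof uses that `v` is then not a proper integral
  multiple of another lattice vector, i.e. `v` is primitive.  The theorem is stated under the
  hypotheses (a) (`minpolyLatticeNormSq_le_iff_aeval_eq_zero`,
  `aeval_eq_zero_iff_minpoly_natDegree_le_of_reduced`) and (a)+(b)
  (`eq_minpoly_or_eq_neg_of_reduced_of_isPrimitive`); the printed `1 ≤ n` is not needed and is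
  dropped.
* Lemma (1.10) needs neither `d ≥ 1` nor the irreducibility of `h` (only `h(α) = 0`), and is
  stated in that generality.

## What is formalised

`approxEval` and Lemma (1.5) (`norm_eval_sub_approxEval_le`); Proposition (1.6)
(`one_le_natDegree_mul_twoNorm_pow_mul_norm_aeval`, `norm_aeval_ge_inv_natDegree_mul_twoNorm_pow`),
by the printed route: the Sylvester matrix
(Mathlib's `Polynomial.sylvester g h m n`, whose first `m` columns are the shifts `Xʲ h` and
last `n` columns the shifts `Xʲ g`, i.e. the printed `M` up to the order of rows), `R ≠ 0` via
`gcd(h, g) = 1` over `ℚ` and Gauss's lemma, `R ≥ 1` by integrality, the row operation and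
expansion (1.7) in the form `det M = g(α) · ∑ⱼ αʲ · adj(M)_{m+j,0}`, and Hadamard's inequality
(the tree's `Literature.LinearAlgebra.Matrix.abs_det_le_prod_sqrt_sum_sq`, column form) for the
cofactors `bⱼ = det(M with column m+j replaced by e₀)`; (1.3)–(1.4) (`minpolyLatticeVector`,
`minpolyLatticeNormSq`, `norm_sq_minpolyLatticeVector`); (1.13)
(`twoNorm_sq_le_succ_mul_sq_of_supNorm_le`); Lemma (1.9): (1.10) `minpolyLatticeNormSq_minpoly_le`
and (1.11) `lt_minpolyLatticeNormSq_of_aeval_ne_zero` under (1.12); Theorem (1.15)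
(`minpolyLatticeNormSq_le_iff_aeval_eq_zero`, `aeval_eq_zero_iff_minpoly_natDegree_le_of_reduced`,
`eq_minpoly_or_eq_neg_of_reduced_of_isPrimitive`).

Not formalised: Theorem (1.1) and its running time (LLL, [16]); Remark (1.8); Algorithm (1.16),
Explanations (1.17)–(1.18) and the complexity statement Theorem (1.19); Sections 2–3.
-/

noncomputable section

open Polynomial Finset Matrix

namespace Literature.NumberTheory.DiophantineApproximation.MinimalPolynomialRecovery

open Literature.Algebra.Polynomial.MignotteBound

/-! ### Notation: the approximated evaluation `g_ᾱ`, norms of integer polynomials -/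

/-- The *approximated evaluation* `f_ᾱ = ∑ᵢ fᵢ ᾱᵢ` of `f ∈ ℂ[X]` at a sequence `ᾱ = (ᾱᵢ)` of
approximations to the powers `αⁱ` (p. 237). [cite: KannanLenstraLovasz1988, §1 (notation g_ᾱ)] -/
def approxEval (a : ℕ → ℂ) (f : ℂ[X]) : ℂ := ∑ i ∈ range (f.natDegree + 1), f.coeff i * a i

/-- `(p ↦ p ∈ ℂ[X])(x) = p(x)` for `p ∈ ℤ[X]`. -/
@[folklore] private theorem eval_map_intCastRingHom_complex (p : ℤ[X]) (x : ℂ) :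
    (p.map (Int.castRingHom ℂ)).eval x = aeval x p := by
  rw [eval_map, aeval_def, algebraMap_int_eq]

/-- `p(x)` computed through `ℚ[X]` is `p(x)`. -/
@[folklore] private theorem aeval_map_ratCast (p : ℤ[X]) (x : ℂ) :
    aeval x (p.map (Int.castRingHom ℚ)) = aeval x p := by
  rw [aeval_def, eval₂_map, RingHom.ext_int ((algebraMap ℚ ℂ).comp (Int.castRingHom ℚ))
    (algebraMap ℤ ℂ), ← aeval_def]

/-- The height of `p ∈ ℤ[X]` equals the height of its image in `ℂ[X]`. -/
@[folklore] private theorem supNorm_map_intCast (p : ℤ[X]) :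
    (p.map (Int.castRingHom ℂ)).supNorm = p.supNorm := by
  rw [supNorm_eq_iSup, supNorm_eq_iSup]
  refine iSup_congr fun i => ?_
  rw [coeff_map, eq_intCast, Complex.norm_intCast, Int.norm_eq_abs]

/-- The image of `p ∈ ℤ[X]` in `ℂ[X]` has the same degree. -/
@[folklore] private theorem natDegree_map_intCastRingHom_complex (p : ℤ[X]) :
    (p.map (Int.castRingHom ℂ)).natDegree = p.natDegree :=
  natDegree_map_eq_of_injective (Int.castRingHom ℂ).injective_int p

/-- A nonzero integer polynomial has height at least `1`. -/
@[folklore] private theorem intPoly_one_le_supNorm {p : ℤ[X]} (hp : p ≠ 0) : 1 ≤ p.supNorm := by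
  refine le_trans ?_ (p.le_supNorm p.natDegree)
  rw [Int.norm_eq_abs]
  exact_mod_cast Int.one_le_abs (leadingCoeff_ne_zero.mpr hp)

/-- A nonzero integer polynomial has length at least `1`. -/
@[folklore] private theorem one_le_twoNorm {p : ℤ[X]} (hp : p ≠ 0) : 1 ≤ twoNorm p :=
  (intPoly_one_le_supNorm hp).trans (supNorm_le_twoNorm p)

/-- **(1.13)**: `|f|² ≤ (d+1) · |f|²_∞` for `f` of degree at most `d`; here with the height
bounded by `H`. [cite: KannanLenstraLovasz1988, (1.13)] -/
theorem twoNorm_sq_le_succ_mul_sq_of_supNorm_le {p : ℤ[X]} {d : ℕ} (hp : p.natDegree ≤ d) {H : ℝ}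
    (hH : p.supNorm ≤ H) :
    twoNorm p ^ 2 ≤ (d + 1) * H ^ 2 := by
  have h0 : 0 ≤ p.supNorm := p.supNorm_nonneg
  calc twoNorm p ^ 2 ≤ (√(p.natDegree + 1) * p.supNorm) ^ 2 :=
        pow_le_pow_left₀ (twoNorm_nonneg p) (twoNorm_le_sqrt_natDegree_add_one_mul_supNorm p) 2
    _ = (p.natDegree + 1) * p.supNorm ^ 2 := by rw [mul_pow, Real.sq_sqrt (by positivity)]
    _ ≤ (d + 1) * H ^ 2 :=
        mul_le_mul (by norm_cast; omega) (pow_le_pow_left₀ h0 hH 2)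
          (by positivity) (by positivity)

/-! ### Lemma (1.5) -/

/-- **Lemma (1.5).** If `ᾱ₀ = 1` and `|αⁱ - ᾱᵢ| ≤ ε` for `1 ≤ i ≤ n`, and `f ∈ ℂ[X]` has degree
at most `n`, then `|f(α) - f_ᾱ| ≤ ε · n · |f|_∞`. [cite: KannanLenstraLovasz1988, Lemma (1.5)] -/
theorem norm_eval_sub_approxEval_le {α : ℂ} {a : ℕ → ℂ} {ε : ℝ} {n : ℕ} (ha₀ : a 0 = 1)
    (ha : ∀ i, 1 ≤ i → i ≤ n → ‖α ^ i - a i‖ ≤ ε) {f : ℂ[X]} (hf : f.natDegree ≤ n) :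
    ‖f.eval α - approxEval a f‖ ≤ ε * n * f.supNorm := by
  have hsub : f.eval α - approxEval a f =
      ∑ i ∈ range f.natDegree, f.coeff (i + 1) * (α ^ (i + 1) - a (i + 1)) := by
    rw [eval_eq_sum_range, approxEval, ← sum_sub_distrib, sum_range_succ']
    simp only [← mul_sub, pow_zero, ha₀, sub_self, add_zero]
  rw [hsub]
  rcases Nat.eq_zero_or_pos n with rfl | hn
  · simp [Nat.le_zero.mp hf]
  have hε : 0 ≤ ε := (norm_nonneg _).trans (ha 1 le_rfl hn)
  calc ‖∑ i ∈ range f.natDegree, f.coeff (i + 1) * (α ^ (i + 1) - a (i + 1))‖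
      ≤ ∑ i ∈ range f.natDegree, ‖f.coeff (i + 1) * (α ^ (i + 1) - a (i + 1))‖ :=
        norm_sum_le _ _
    _ ≤ ∑ _i ∈ range f.natDegree, f.supNorm * ε := by
        refine sum_le_sum fun i hi => ?_
        have hi' : i + 1 ≤ n := (mem_range.mp hi).trans_le hf
        rw [norm_mul]
        exact mul_le_mul (f.le_supNorm _) (ha _ (Nat.succ_pos i) hi') (norm_nonneg _)
          f.supNorm_nonneg
    _ = f.natDegree * (f.supNorm * ε) := by rw [sum_const, card_range, nsmul_eq_mul]
    _ ≤ n * (f.supNorm * ε) :=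
        mul_le_mul_of_nonneg_right (Nat.cast_le.mpr hf) (mul_nonneg f.supNorm_nonneg hε)
    _ = ε * n * f.supNorm := by ring

/-! ### Proposition (1.6): the resultant argument -/

/-- A partial sum of squares of coefficients is at most `|g|²`. -/
@[folklore] private theorem sum_sq_coeff_subset_le_twoNorm_sq (g : ℤ[X]) (S : Finset ℕ) :
    ∑ s ∈ S, ((g.coeff s : ℤ) : ℝ) ^ 2 ≤ twoNorm g ^ 2 := by
  rw [twoNorm_sq]
  calc ∑ s ∈ S, ((g.coeff s : ℤ) : ℝ) ^ 2 = ∑ s ∈ S, ‖g.coeff s‖ ^ 2 :=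
        Finset.sum_congr rfl fun s _ => by rw [Int.norm_eq_abs, sq_abs]
    _ ≤ ∑ s ∈ S ∪ g.support, ‖g.coeff s‖ ^ 2 :=
        sum_le_sum_of_subset_of_nonneg subset_union_left fun _ _ _ => sq_nonneg _
    _ = ∑ s ∈ g.support, ‖g.coeff s‖ ^ 2 :=
        (sum_subset subset_union_right fun s _ hs => by
          rw [notMem_support_iff.mp hs, norm_zero, zero_pow two_ne_zero]).symm

/-- The squared Euclidean norm of one of the first `m` columns of `Syl(f, g)` (a shift of the
coefficient vector of `g`) is at most `|g|²`. -/
@[folklore] private theorem sum_sq_sylvester_castAdd_le (f g : ℤ[X]) (m n : ℕ) (j : Fin m) :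
    ∑ i : Fin (m + n), ((sylvester f g m n i (Fin.castAdd n j) : ℤ) : ℝ) ^ 2 ≤ twoNorm g ^ 2 := by
  have hcol : ∀ i : Fin (m + n), ((sylvester f g m n i (Fin.castAdd n j) : ℤ) : ℝ) ^ 2 =
      if (j : ℕ) ≤ i ∧ (i : ℕ) ≤ j + n then ((g.coeff (i - j) : ℤ) : ℝ) ^ 2 else 0 := by
    intro i
    rw [sylvester, Matrix.of_apply, Fin.addCases_left]
    simp only [Set.mem_Icc]
    split_ifs <;> simp
  simp_rw [hcol]
  rw [Fin.sum_univ_eq_sum_range (fun i => if (j : ℕ) ≤ i ∧ i ≤ j + n then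
    ((g.coeff (i - j) : ℤ) : ℝ) ^ 2 else 0) (m + n), ← Finset.sum_filter]
  have hinj : Set.InjOn (fun i => i - (j : ℕ))
      ↑((range (m + n)).filter fun i => (j : ℕ) ≤ i ∧ i ≤ j + n) := by
    intro x hx y hy hxy
    simp only [coe_filter, Set.mem_setOf_eq] at hx hy
    simp only at hxy
    omega
  rw [← Finset.sum_image (f := fun s => ((g.coeff s : ℤ) : ℝ) ^ 2) hinj]
  exact sum_sq_coeff_subset_le_twoNorm_sq g _

/-- The squared Euclidean norm of one of the last `n` columns of `Syl(f, g)` (a shift of the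
coefficient vector of `f`) is at most `|f|²`. -/
@[folklore] private theorem sum_sq_sylvester_natAdd_le (f g : ℤ[X]) (m n : ℕ) (j : Fin n) :
    ∑ i : Fin (m + n), ((sylvester f g m n i (Fin.natAdd m j) : ℤ) : ℝ) ^ 2 ≤ twoNorm f ^ 2 := by
  have hcol : ∀ i : Fin (m + n), ((sylvester f g m n i (Fin.natAdd m j) : ℤ) : ℝ) ^ 2 =
      if (j : ℕ) ≤ i ∧ (i : ℕ) ≤ j + m then ((f.coeff (i - j) : ℤ) : ℝ) ^ 2 else 0 := by
    intro i
    rw [sylvester, Matrix.of_apply, Fin.addCases_right]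
    simp only [Set.mem_Icc]
    split_ifs <;> simp
  simp_rw [hcol]
  rw [Fin.sum_univ_eq_sum_range (fun i => if (j : ℕ) ≤ i ∧ i ≤ j + m then
    ((f.coeff (i - j) : ℤ) : ℝ) ^ 2 else 0) (m + n), ← Finset.sum_filter]
  have hinj : Set.InjOn (fun i => i - (j : ℕ))
      ↑((range (m + n)).filter fun i => (j : ℕ) ≤ i ∧ i ≤ j + m) := by
    intro x hx y hy hxy
    simp only [coe_filter, Set.mem_setOf_eq] at hx hy
    simp only at hxy
    omega
  rw [← Finset.sum_image (f := fun s => ((f.coeff s : ℤ) : ℝ) ^ 2) hinj]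
  exact sum_sq_coeff_subset_le_twoNorm_sq f _

/-- The row operation of the printed proof: `∑ᵢ αⁱ · (column "Xᶜ · p")ᵢ = αᶜ · p(α)`. -/
@[folklore] private theorem sum_pow_mul_window (p : ℤ[X]) {k N c : ℕ} (hp : p.natDegree ≤ k)
    (hc : c + k < N) (x : ℂ) :
    ∑ i : Fin N, x ^ (i : ℕ) *
        (if (i : ℕ) ∈ Set.Icc c (c + k) then ((p.coeff (i - c) : ℤ) : ℂ) else 0) =
      x ^ c * aeval x p := by
  rw [Fin.sum_univ_eq_sum_range (fun i => x ^ i *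
      (if i ∈ Set.Icc c (c + k) then ((p.coeff (i - c) : ℤ) : ℂ) else 0)) N,
    aeval_eq_sum_range' (Nat.lt_succ_of_le hp), mul_sum]
  have hsub : (range (k + 1)).map (addLeftEmbedding c) ⊆ range N := by
    intro i hi
    obtain ⟨t, ht, rfl⟩ := mem_map.mp hi
    rw [mem_range] at ht ⊢
    rw [addLeftEmbedding_apply]
    omega
  have hzero : ∀ i ∈ range N, i ∉ (range (k + 1)).map (addLeftEmbedding c) →
      x ^ i * (if i ∈ Set.Icc c (c + k) then ((p.coeff (i - c) : ℤ) : ℂ) else 0) = 0 := by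
    intro i _ hi
    rw [if_neg, mul_zero]
    intro hmem
    rw [Set.mem_Icc] at hmem
    exact hi (mem_map.mpr ⟨i - c, mem_range.mpr (by omega),
      by rw [addLeftEmbedding_apply]; omega⟩)
  rw [← sum_subset hsub hzero, sum_map]
  refine sum_congr rfl fun t ht => ?_
  have ht' : t ≤ k := Nat.lt_succ_iff.mp (mem_range.mp ht)
  rw [addLeftEmbedding_apply, if_pos (Set.mem_Icc.mpr ⟨Nat.le_add_right c t, by omega⟩),
    Nat.add_sub_cancel_left, Algebra.smul_def, algebraMap_int_eq, eq_intCast, pow_add]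
  ring

/-- Cramer / the adjugate: `adj(A)_{i,j}` is the determinant of `A` with column `i` replaced by
the unit vector `e_j`. -/
@[folklore] private theorem adjugate_apply_eq_det_updateCol {ι R : Type*} [Fintype ι]
    [DecidableEq ι] [CommRing R] (A : Matrix ι ι R) (i j : ι) :
    A.adjugate i j = (A.updateCol i (Pi.single j 1)).det := by
  rw [← transpose_apply A.adjugate j i, adjugate_transpose, adjugate_def, of_apply,
    transpose_transpose, cramer_apply]

/-- Hadamard's inequality for the cofactors `bⱼ` of the printed proof: the determinant of the
Sylvester matrix with one of its `g`-columns replaced by a unit vector is at most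
`|h|^m · |g|^{n-1}` in absolute value (its other columns are `m` shifts of `h` and `n - 1`
shifts of `g`). -/
@[folklore] private theorem abs_det_updateCol_sylvester_le (g h : ℤ[X]) (m n : ℕ) (j₁ : Fin n)
    (i₀ : Fin (m + n)) :
    (|(((sylvester g h m n).updateCol (Fin.natAdd m j₁) (Pi.single i₀ 1)).det : ℤ)| : ℝ) ≤
      twoNorm h ^ m * twoNorm g ^ (n - 1) := by
  obtain ⟨B, hB⟩ : ∃ B : Matrix (Fin (m + n)) (Fin (m + n)) ℝ, B = (Int.castRingHom ℝ).mapMatrix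
      ((sylvester g h m n).updateCol (Fin.natAdd m j₁) (Pi.single i₀ 1)) := ⟨_, rfl⟩
  have hBapply : ∀ i c, B i c = if c = Fin.natAdd m j₁ then (if i = i₀ then (1 : ℝ) else 0)
      else ((sylvester g h m n i c : ℤ) : ℝ) := by
    intro i c
    rw [hB, RingHom.mapMatrix_apply, Matrix.map_apply, updateCol_apply, Pi.single_apply]
    split_ifs <;> simp
  have hdet : ((((sylvester g h m n).updateCol (Fin.natAdd m j₁) (Pi.single i₀ 1)).det : ℤ) : ℝ)
      = B.det := by
    rw [hB, ← RingHom.map_det, eq_intCast]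
  rw [hdet]
  refine (Literature.LinearAlgebra.Matrix.abs_det_le_prod_sqrt_sum_sq B).trans ?_
  rw [Fin.prod_univ_add]
  refine mul_le_mul ?_ ?_ (prod_nonneg fun _ _ => Real.sqrt_nonneg _)
    (pow_nonneg (twoNorm_nonneg h) _)
  · rw [show twoNorm h ^ m = ∏ _c : Fin m, twoNorm h by
      rw [prod_const, card_univ, Fintype.card_fin]]
    refine prod_le_prod (fun _ _ => Real.sqrt_nonneg _) fun c _ => ?_
    have hne : Fin.castAdd n c ≠ Fin.natAdd m j₁ := by
      intro hcj
      have := congrArg Fin.val hcj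
      simp only [Fin.val_castAdd, Fin.val_natAdd] at this
      omega
    simp_rw [hBapply, if_neg hne]
    rw [← Real.sqrt_sq (twoNorm_nonneg h)]
    exact Real.sqrt_le_sqrt (sum_sq_sylvester_castAdd_le g h m n c)
  · calc ∏ c : Fin n, √(∑ i, B i (Fin.natAdd m c) ^ 2)
        ≤ ∏ c : Fin n, (if c = j₁ then (1 : ℝ) else twoNorm g) := by
          refine prod_le_prod (fun _ _ => Real.sqrt_nonneg _) fun c _ => ?_
          by_cases hc : c = j₁
          · subst hc
            have hsum1 : ∑ i, B i (Fin.natAdd m c) ^ 2 = 1 := by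
              rw [Finset.sum_eq_single_of_mem i₀ (mem_univ _) (fun b _ hb => by
                rw [hBapply, if_pos rfl, if_neg hb]; ring), hBapply, if_pos rfl, if_pos rfl,
                one_pow]
            rw [hsum1, Real.sqrt_one, if_pos rfl]
          · have hne : Fin.natAdd m c ≠ Fin.natAdd m j₁ := by
              intro hcj
              apply hc
              ext
              have := congrArg Fin.val hcj
              simp only [Fin.val_natAdd] at this
              omega
            simp_rw [hBapply, if_neg hne, if_neg hc]
            rw [← Real.sqrt_sq (twoNorm_nonneg g)]
            exact Real.sqrt_le_sqrt (sum_sq_sylvester_natAdd_le g h m n c)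
      _ = twoNorm g ^ (n - 1) := by
          rw [← mul_prod_erase univ _ (mem_univ j₁), if_pos rfl, one_mul,
            prod_congr rfl fun c hc => if_neg (ne_of_mem_erase hc), prod_const,
            card_erase_of_mem (mem_univ j₁), card_univ, Fintype.card_fin]

/-- For `h` irreducible with a root `α` and `g(α) ≠ 0`, `h` and `g` are coprime in `ℚ[X]`
("`gcd(h, g) = 1`" in the printed proof of (1.6)). -/
@[folklore] private theorem isCoprime_map_of_aeval_ne_zero {h g : ℤ[X]} (hh : Irreducible h)
    (hn : h.natDegree ≠ 0) {α : ℂ} (hα : aeval α h = 0) (hg : aeval α g ≠ 0) :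
    IsCoprime (g.map (Int.castRingHom ℚ)) (h.map (Int.castRingHom ℚ)) := by
  have hirr : Irreducible (h.map (Int.castRingHom ℚ)) :=
    (IsPrimitive.Int.irreducible_iff_irreducible_map_cast (hh.isPrimitive hn)).mp hh
  refine ((dvd_or_isCoprime _ _ hirr).resolve_left ?_).symm
  rintro ⟨q, hq⟩
  apply hg
  rw [← aeval_map_ratCast, hq, map_mul, aeval_map_ratCast, hα, zero_mul]

/-- For `h` irreducible with a root `α`, every `v ∈ ℤ[X]` with `v(α) = 0` is divisible by `h`
in `ℚ[X]` (used in the proof of Theorem (1.15): "`h` is a factor of `v`"). -/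
@[folklore] private theorem map_dvd_map_of_aeval_eq_zero {h v : ℤ[X]} (hh : Irreducible h)
    (hn : h.natDegree ≠ 0) {α : ℂ} (hα : aeval α h = 0) (hv : aeval α v = 0) :
    h.map (Int.castRingHom ℚ) ∣ v.map (Int.castRingHom ℚ) := by
  have hirr : Irreducible (h.map (Int.castRingHom ℚ)) :=
    (IsPrimitive.Int.irreducible_iff_irreducible_map_cast (hh.isPrimitive hn)).mp hh
  refine (dvd_or_isCoprime _ _ hirr).resolve_right fun hcop => ?_
  obtain ⟨a, b, hab⟩ := hcop
  have := congrArg (aeval α) hab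
  rw [map_add, map_mul, map_mul, aeval_map_ratCast, aeval_map_ratCast, hα, hv, mul_zero,
    mul_zero, zero_add, map_one] at this
  exact zero_ne_one this

/-- An irreducible `h ∈ ℤ[X]` with a complex root has positive degree ("`n ≥ 1`"). -/
@[folklore] private theorem natDegree_ne_zero_of_irreducible_of_aeval_eq_zero {h : ℤ[X]}
    (hh : Irreducible h) {α : ℂ} (hα : aeval α h = 0) : h.natDegree ≠ 0 := by
  intro hdeg
  rw [eq_C_of_natDegree_eq_zero hdeg, aeval_C, algebraMap_int_eq, eq_intCast,
    Int.cast_eq_zero] at hα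
  exact hh.ne_zero (by rw [eq_C_of_natDegree_eq_zero hdeg, hα, C_0])

/-- **Proposition (1.6)**, product form: for `h, g ∈ ℤ[X]` with `h` irreducible, `h(α) = 0`,
`|α| ≤ 1` and `g(α) ≠ 0` (`n = deg h`, `m = deg g`),
`1 ≤ n · |h|^m · |g|^{n-1} · |g(α)|`. [cite: KannanLenstraLovasz1988, Proposition (1.6)] -/
theorem one_le_natDegree_mul_twoNorm_pow_mul_norm_aeval {h g : ℤ[X]} (hh : Irreducible h) {α : ℂ}
    (hα : aeval α h = 0)
    (hα₁ : ‖α‖ ≤ 1) (hg : aeval α g ≠ 0) :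
    1 ≤ (h.natDegree : ℝ) * twoNorm h ^ g.natDegree * twoNorm g ^ (h.natDegree - 1) *
      ‖aeval α g‖ := by
  have hn : h.natDegree ≠ 0 := natDegree_ne_zero_of_irreducible_of_aeval_eq_zero hh hα
  have hg0 : g ≠ 0 := by
    rintro rfl
    exact hg (map_zero _)
  have hn1 : (1 : ℝ) ≤ h.natDegree := Nat.one_le_cast.mpr (Nat.one_le_iff_ne_zero.mpr hn)
  -- the case `m = 0`: `g` is a nonzero constant
  rcases Nat.eq_zero_or_pos g.natDegree with hm | hm
  · obtain ⟨c, rfl⟩ : ∃ c, g = C c := ⟨_, eq_C_of_natDegree_eq_zero hm⟩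
    have hc : c ≠ 0 := by
      rintro rfl
      exact hg0 C_0
    have hval : (1 : ℝ) ≤ ‖aeval α (C c)‖ := by
      rw [aeval_C, algebraMap_int_eq, eq_intCast, Complex.norm_intCast]
      exact_mod_cast Int.one_le_abs hc
    rw [natDegree_C, pow_zero]
    exact one_le_mul_of_one_le_of_one_le (one_le_mul_of_one_le_of_one_le
      (by rw [mul_one]; exact hn1) (one_le_pow₀ (one_le_twoNorm hg0))) hval
  -- the case `m ≥ 1`: the Sylvester matrix `M` and the resultant `R = det M`
  obtain ⟨S, hS⟩ :
      ∃ S : Matrix (Fin (g.natDegree + h.natDegree)) (Fin (g.natDegree + h.natDegree)) ℤ,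
      S = sylvester g h g.natDegree h.natDegree := ⟨_, rfl⟩
  -- `R ≠ 0`, hence `|R| ≥ 1`
  have hR : S.det ≠ 0 := by
    have hres := resultant_ne_zero _ _ (isCoprime_map_of_aeval_ne_zero hh hn hα hg)
    rw [natDegree_map_eq_of_injective (Int.castRingHom ℚ).injective_int,
      natDegree_map_eq_of_injective (Int.castRingHom ℚ).injective_int, resultant_map_map] at hres
    intro hdet
    apply hres
    rw [show resultant g h g.natDegree h.natDegree = S.det from by rw [hS]; rfl, hdet, map_zero]
  have hR1 : (1 : ℝ) ≤ |(S.det : ℝ)| := by exact_mod_cast Int.one_le_abs hR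
  -- the matrix over `ℂ`
  obtain ⟨T, hT⟩ :
      ∃ T : Matrix (Fin (g.natDegree + h.natDegree)) (Fin (g.natDegree + h.natDegree)) ℂ,
      T = (Int.castRingHom ℂ).mapMatrix S := ⟨_, rfl⟩
  have hTsyl : T = sylvester (g.map (Int.castRingHom ℂ)) (h.map (Int.castRingHom ℂ))
      g.natDegree h.natDegree := by
    rw [hT, hS, sylvester_map_map]
  have hTdet : T.det = ((S.det : ℤ) : ℂ) := by
    rw [hT, ← RingHom.map_det, eq_intCast]
  have hTadj : ∀ i j, T.adjugate i j = ((S.adjugate i j : ℤ) : ℂ) := by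
    intro i j
    rw [hT, ← RingHom.map_adjugate, RingHom.mapMatrix_apply, Matrix.map_apply, eq_intCast]
  have hN : 0 < g.natDegree + h.natDegree := by omega
  -- the row operation: `(α⁰, α¹, …) · M = g(α) · (0, …, 0, α⁰, …, α^{n-1})`, as `h(α) = 0`
  obtain ⟨u, hu⟩ : ∃ u : Fin (g.natDegree + h.natDegree) → ℂ,
      u = Fin.append (fun _ : Fin g.natDegree => (0 : ℂ))
        (fun j₁ : Fin h.natDegree => α ^ (j₁ : ℕ)) := ⟨_, rfl⟩
  have hwT : (fun i : Fin (g.natDegree + h.natDegree) => α ^ (i : ℕ)) ᵥ* T = aeval α g • u := by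
    ext j
    rw [Pi.smul_apply, smul_eq_mul]
    change ∑ i : Fin (g.natDegree + h.natDegree), α ^ (i : ℕ) * T i j = aeval α g * u j
    rw [hTsyl, hu]
    induction j using Fin.addCases with
    | left j₁ =>
      have hj : (j₁ : ℕ) < g.natDegree := j₁.isLt
      simp only [sylvester, Matrix.of_apply, Fin.addCases_left, Fin.append_left, coeff_map,
        eq_intCast]
      rw [sum_pow_mul_window h (c := (j₁ : ℕ)) (N := g.natDegree + h.natDegree) le_rfl
        (by omega) α, hα, mul_zero, mul_zero]
    | right j₁ =>
      have hj : (j₁ : ℕ) < h.natDegree := j₁.isLt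
      simp only [sylvester, Matrix.of_apply, Fin.addCases_right, Fin.append_right, coeff_map,
        eq_intCast]
      rw [sum_pow_mul_window g (c := (j₁ : ℕ)) (N := g.natDegree + h.natDegree) le_rfl
        (by omega) α, mul_comm]
  -- expansion (1.7): `det M = g(α) · ∑ⱼ αʲ · adj(M)_{m+j, 0}`
  have key : ((S.det : ℤ) : ℂ) = aeval α g *
      ∑ j₁ : Fin h.natDegree, α ^ (j₁ : ℕ) * T.adjugate (Fin.natAdd g.natDegree j₁) ⟨0, hN⟩ := by
    have h1 : (fun i : Fin (g.natDegree + h.natDegree) => α ^ (i : ℕ)) ᵥ* T ᵥ* T.adjugate =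
        T.det • fun i : Fin (g.natDegree + h.natDegree) => α ^ (i : ℕ) := by
      rw [Matrix.vecMul_vecMul, mul_adjugate, Matrix.vecMul_smul, Matrix.vecMul_one]
    have h2 := congrFun h1 ⟨0, hN⟩
    rw [hwT, Pi.smul_apply, smul_eq_mul, pow_zero, mul_one, hTdet] at h2
    rw [← h2]
    change ∑ j : Fin (g.natDegree + h.natDegree), (aeval α g • u) j * T.adjugate j ⟨0, hN⟩ = _
    simp only [hu, Pi.smul_apply, smul_eq_mul, Fin.sum_univ_add, Fin.append_left,
      Fin.append_right, mul_zero, zero_mul, sum_const_zero, zero_add, mul_sum, mul_assoc]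
  -- Hadamard: `|bⱼ| ≤ |h|^m · |g|^{n-1}`
  have hK : ∀ j₁ : Fin h.natDegree, ‖T.adjugate (Fin.natAdd g.natDegree j₁) ⟨0, hN⟩‖ ≤
      twoNorm h ^ g.natDegree * twoNorm g ^ (h.natDegree - 1) := by
    intro j₁
    rw [hTadj, Complex.norm_intCast, adjugate_apply_eq_det_updateCol, hS]
    exact abs_det_updateCol_sylvester_le g h _ _ j₁ ⟨0, hN⟩
  -- `|∑ⱼ αʲ bⱼ| ≤ n · |h|^m · |g|^{n-1}` as `|α| ≤ 1`
  have hsum :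
      ‖∑ j₁ : Fin h.natDegree, α ^ (j₁ : ℕ) * T.adjugate (Fin.natAdd g.natDegree j₁) ⟨0, hN⟩‖
      ≤ h.natDegree * (twoNorm h ^ g.natDegree * twoNorm g ^ (h.natDegree - 1)) := by
    refine (norm_sum_le _ _).trans ?_
    calc ∑ j₁ : Fin h.natDegree, ‖α ^ (j₁ : ℕ) * T.adjugate (Fin.natAdd g.natDegree j₁) ⟨0, hN⟩‖
        ≤ ∑ _j₁ : Fin h.natDegree, twoNorm h ^ g.natDegree * twoNorm g ^ (h.natDegree - 1) := by
          refine sum_le_sum fun j₁ _ => ?_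
          rw [norm_mul, norm_pow]
          calc ‖α‖ ^ (j₁ : ℕ) * ‖T.adjugate (Fin.natAdd g.natDegree j₁) ⟨0, hN⟩‖
              ≤ 1 * (twoNorm h ^ g.natDegree * twoNorm g ^ (h.natDegree - 1)) :=
                mul_le_mul (pow_le_one₀ (norm_nonneg α) hα₁) (hK j₁) (norm_nonneg _) zero_le_one
            _ = _ := one_mul _
      _ = h.natDegree * (twoNorm h ^ g.natDegree * twoNorm g ^ (h.natDegree - 1)) := by
          rw [sum_const, card_univ, Fintype.card_fin, nsmul_eq_mul]
  -- `1 ≤ R = |g(α)| · |∑ⱼ αʲ bⱼ|`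
  calc (1 : ℝ) ≤ |(S.det : ℝ)| := hR1
    _ = ‖((S.det : ℤ) : ℂ)‖ := (Complex.norm_intCast _).symm
    _ = ‖aeval α g‖ * ‖∑ j₁ : Fin h.natDegree,
          α ^ (j₁ : ℕ) * T.adjugate (Fin.natAdd g.natDegree j₁) ⟨0, hN⟩‖ := by
        rw [key, norm_mul]
    _ ≤ ‖aeval α g‖ * (h.natDegree * (twoNorm h ^ g.natDegree * twoNorm g ^ (h.natDegree - 1))) :=
        mul_le_mul_of_nonneg_left hsum (norm_nonneg _)
    _ = _ := by ring

/-- **Proposition (1.6)** as printed: `|g(α)| ≥ n⁻¹ · |h|^{-m} · |g|^{-n+1}`.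
[cite: KannanLenstraLovasz1988, Proposition (1.6)] -/
theorem norm_aeval_ge_inv_natDegree_mul_twoNorm_pow {h g : ℤ[X]} (hh : Irreducible h) {α : ℂ}
    (hα : aeval α h = 0)
    (hα₁ : ‖α‖ ≤ 1) (hg : aeval α g ≠ 0) :
    (h.natDegree : ℝ)⁻¹ * (twoNorm h ^ g.natDegree)⁻¹ * (twoNorm g ^ (h.natDegree - 1))⁻¹ ≤
      ‖aeval α g‖ := by
  have H := one_le_natDegree_mul_twoNorm_pow_mul_norm_aeval hh hα hα₁ hg
  have hpos : 0 < (h.natDegree : ℝ) * twoNorm h ^ g.natDegree * twoNorm g ^ (h.natDegree - 1) := by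
    rcases le_or_gt ((h.natDegree : ℝ) * twoNorm h ^ g.natDegree * twoNorm g ^ (h.natDegree - 1))
      0 with hle | hlt
    · nlinarith [norm_nonneg (aeval α g)]
    · exact hlt
  rw [← mul_inv, ← mul_inv]
  exact (inv_le_iff_one_le_mul₀' hpos).mpr H

/-! ### (1.3)–(1.4): the lattice vectors `g̃` -/

/-- The right-hand side of (1.4): `|g|² + 2^{2s} |g_ᾱ|²`, the squared length of the lattice
vector `g̃ ∈ L_s` attached to `g ∈ ℤ[X]`. [cite: KannanLenstraLovasz1988, (1.4)] -/
def minpolyLatticeNormSq (s : ℕ) (a : ℕ → ℂ) (g : ℤ[X]) : ℝ :=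
  twoNorm g ^ 2 + ((2 : ℝ) ^ s * ‖approxEval a (g.map (Int.castRingHom ℂ))‖) ^ 2

/-- (1.3)–(1.4): the vector `g̃ = ∑_{i=0}^n gᵢ bᵢ ∈ ℝ^{n+3}` of the lattice
`L_s = L(b₀, …, bₙ)`, `bᵢ = (eᵢ, 2^s Re ᾱᵢ, 2^s Im ᾱᵢ)`: its coordinates are
`(g₀, g₁, …, gₙ, 2^s Re g_ᾱ, 2^s Im g_ᾱ)`. [cite: KannanLenstraLovasz1988, (1.3)–(1.4)] -/
def minpolyLatticeVector (s : ℕ) (a : ℕ → ℂ) (n : ℕ) (g : ℤ[X]) : EuclideanSpace ℝ (Fin (n + 3)) :=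
  WithLp.toLp 2 fun k : Fin (n + 3) =>
    if (k : ℕ) ≤ n then ((g.coeff k : ℤ) : ℝ)
    else if (k : ℕ) = n + 1 then (2 : ℝ) ^ s * (approxEval a (g.map (Int.castRingHom ℂ))).re
    else (2 : ℝ) ^ s * (approxEval a (g.map (Int.castRingHom ℂ))).im

/-- **(1.4)**: `|g̃|² = |g|² + 2^{2s} |g_ᾱ|²` for `g ∈ ℤ[X]` of degree at most `n`.
[cite: KannanLenstraLovasz1988, (1.4)] -/
theorem norm_sq_minpolyLatticeVector (s : ℕ) (a : ℕ → ℂ) {n : ℕ} {g : ℤ[X]} (hg : g.natDegree ≤ n) :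
    ‖minpolyLatticeVector s a n g‖ ^ 2 = minpolyLatticeNormSq s a g := by
  rw [EuclideanSpace.real_norm_sq_eq, Fin.sum_univ_add, Fin.sum_univ_three]
  have hcoe : ∀ i : Fin n,
      minpolyLatticeVector s a n g (Fin.castAdd 3 i) = ((g.coeff i : ℤ) : ℝ) := by
    intro i
    have hi : (i : ℕ) ≤ n := i.isLt.le
    simp [minpolyLatticeVector, hi]
  have h0 : minpolyLatticeVector s a n g (Fin.natAdd n 0) = ((g.coeff n : ℤ) : ℝ) := by
    simp [minpolyLatticeVector]
  have h1 : minpolyLatticeVector s a n g (Fin.natAdd n 1) =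
      (2 : ℝ) ^ s * (approxEval a (g.map (Int.castRingHom ℂ))).re := by
    simp [minpolyLatticeVector]
  have h2 : minpolyLatticeVector s a n g (Fin.natAdd n 2) =
      (2 : ℝ) ^ s * (approxEval a (g.map (Int.castRingHom ℂ))).im := by
    simp [minpolyLatticeVector]
  simp_rw [hcoe, h0, h1, h2]
  have hsq : twoNorm g ^ 2 =
      ∑ i : Fin n, ((g.coeff i : ℤ) : ℝ) ^ 2 + ((g.coeff n : ℤ) : ℝ) ^ 2 := by
    rw [twoNorm_sq_eq_cast, Fin.sum_univ_eq_sum_range (fun i => ((g.coeff i : ℤ) : ℝ) ^ 2) n,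
      ← sum_range_succ, sum_subset (range_subset_range.mpr (Nat.succ_le_succ hg))]
    · push_cast
      rfl
    · intro i _ hi
      rw [mem_range, not_lt] at hi
      rw [coeff_eq_zero_of_natDegree_lt (by omega)]
      simp
  rw [minpolyLatticeNormSq, hsq, mul_pow, mul_pow, mul_pow, Complex.sq_norm, Complex.normSq_apply]
  ring

/-! ### Lemma (1.9) -/

/-- **Lemma (1.9), (1.10).** If `h(α) = 0`, `deg h ≤ d`, `|h|_∞ ≤ H`, `ᾱ₀ = 1` and
`|αⁱ - ᾱᵢ| ≤ 2^{-s}` for `1 ≤ i ≤ d`, then `|h̃| ≤ (d+1) · H`, i.e. `|h̃|² ≤ ((d+1) H)²`.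
[cite: KannanLenstraLovasz1988, Lemma (1.9) (1.10)] -/
theorem minpolyLatticeNormSq_minpoly_le {α : ℂ} {h : ℤ[X]} (hα : aeval α h = 0) {d : ℕ}
    (hhd : h.natDegree ≤ d) {H : ℝ} (hH : h.supNorm ≤ H) {a : ℕ → ℂ} {s : ℕ} (ha₀ : a 0 = 1)
    (ha : ∀ i, 1 ≤ i → i ≤ d → ‖α ^ i - a i‖ ≤ ((2 : ℝ) ^ s)⁻¹) :
    minpolyLatticeNormSq s a h ≤ ((d + 1) * H) ^ 2 := by
  have hsup : 0 ≤ h.supNorm := h.supNorm_nonneg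
  have hH0 : 0 ≤ H := hsup.trans hH
  -- `|h_ᾱ| = |h(α) - h_ᾱ| ≤ 2^{-s} · d · H` (Lemma (1.5))
  have h15 := norm_eval_sub_approxEval_le ha₀ ha (f := h.map (Int.castRingHom ℂ))
    (by rw [natDegree_map_intCastRingHom_complex]; exact hhd)
  rw [eval_map_intCastRingHom_complex, hα, zero_sub, norm_neg, supNorm_map_intCast] at h15
  have happ : (2 : ℝ) ^ s * ‖approxEval a (h.map (Int.castRingHom ℂ))‖ ≤ d * H := by
    calc (2 : ℝ) ^ s * ‖approxEval a (h.map (Int.castRingHom ℂ))‖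
        ≤ (2 : ℝ) ^ s * (((2 : ℝ) ^ s)⁻¹ * d * h.supNorm) :=
          mul_le_mul_of_nonneg_left h15 (by positivity)
      _ = d * h.supNorm := by field_simp
      _ ≤ d * H := mul_le_mul_of_nonneg_left hH (by positivity)
  -- `|h|² ≤ (d+1) · H²` by (1.13)
  have hlen := twoNorm_sq_le_succ_mul_sq_of_supNorm_le hhd hH
  have happ2 : ((2 : ℝ) ^ s * ‖approxEval a (h.map (Int.castRingHom ℂ))‖) ^ 2 ≤ (d * H) ^ 2 :=
    pow_le_pow_left₀ (by positivity) happ 2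
  rw [minpolyLatticeNormSq]
  nlinarith [sq_nonneg H, Nat.cast_nonneg (α := ℝ) d]

/-- **Lemma (1.9), (1.11).** Under the hypotheses of Lemma (1.9) — `|α| ≤ 1`, `h` the minimal
polynomial of `α` (irreducible in `ℤ[X]`, `h(α) = 0`) of degree at most `d ≥ 1` and height at
most `H`, `ᾱ₀ = 1`, `|αⁱ - ᾱᵢ| ≤ 2^{-s}` for `1 ≤ i ≤ d`, and (1.12)
`2^s ≥ 2^{d²/2} · (d+1)^{(3d+4)/2} · H^{2d}` — every `g ∈ ℤ[X]` of degree at most `d` with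
`g(α) ≠ 0` satisfies `|g̃| > 2^{d/2} · (d+1) · H`, i.e. `|g̃|² > 2^d ((d+1) H)²`.
[cite: KannanLenstraLovasz1988, Lemma (1.9) (1.11)] -/
theorem lt_minpolyLatticeNormSq_of_aeval_ne_zero {α : ℂ} (hα₁ : ‖α‖ ≤ 1) {h : ℤ[X]}
    (hh : Irreducible h) (hα : aeval α h = 0) {d : ℕ} (hd : 1 ≤ d) (hhd : h.natDegree ≤ d)
    {H : ℝ} (hH : h.supNorm ≤ H) {a : ℕ → ℂ} {s : ℕ} (ha₀ : a 0 = 1)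
    (ha : ∀ i, 1 ≤ i → i ≤ d → ‖α ^ i - a i‖ ≤ ((2 : ℝ) ^ s)⁻¹)
    (hs : √2 ^ (d ^ 2) * √(d + 1) ^ (3 * d + 4) * H ^ (2 * d) ≤ (2 : ℝ) ^ s)
    {g : ℤ[X]} (hgd : g.natDegree ≤ d) (hg : aeval α g ≠ 0) :
    (2 : ℝ) ^ d * ((d + 1) * H) ^ 2 < minpolyLatticeNormSq s a g := by
  have hg0 : g ≠ 0 := by
    rintro rfl
    exact hg (map_zero _)
  have hn : h.natDegree ≠ 0 := natDegree_ne_zero_of_irreducible_of_aeval_eq_zero hh hα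
  have hH1 : 1 ≤ H := (intPoly_one_le_supNorm hh.ne_zero).trans hH
  have hg1 : 1 ≤ twoNorm g := one_le_twoNorm hg0
  -- abbreviations: `t = √2`, `u = √(d+1)`, `G₀ = 2^{d/2} (d+1) H = t^d u² H`
  obtain ⟨t, ht⟩ : ∃ t : ℝ, t = √2 := ⟨_, rfl⟩
  obtain ⟨u, hu⟩ : ∃ u : ℝ, u = √(d + 1) := ⟨_, rfl⟩
  have ht2 : t ^ 2 = 2 := by rw [ht, Real.sq_sqrt (by norm_num)]
  have hu2 : u ^ 2 = d + 1 := by rw [hu, Real.sq_sqrt (by positivity)]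
  have ht1 : 1 ≤ t := by rw [ht]; exact Real.one_le_sqrt.mpr (by norm_num)
  have hu1 : 1 ≤ u := by
    rw [hu]
    exact Real.one_le_sqrt.mpr (by simp)
  have hdu : (d : ℝ) ≤ u ^ 2 := by rw [hu2]; simp
  obtain ⟨G, hG⟩ : ∃ G : ℝ, G = t ^ d * u ^ 2 * H := ⟨_, rfl⟩
  have hG1 : 1 ≤ G := by
    rw [hG]
    exact one_le_mul_of_one_le_of_one_le (one_le_mul_of_one_le_of_one_le (one_le_pow₀ ht1)
      (one_le_pow₀ hu1)) hH1
  have hG0 : 0 ≤ G := zero_le_one.trans hG1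
  have hbound : (2 : ℝ) ^ d * ((d + 1) * H) ^ 2 = G ^ 2 := by
    rw [hG, ← ht2, ← hu2]
    ring
  rw [hbound, minpolyLatticeNormSq]
  rcases lt_or_ge G (twoNorm g) with hcase | hcase
  · -- `|g| > G₀`: then `|g̃|² ≥ |g|² > G₀²`
    nlinarith [sq_nonneg ((2 : ℝ) ^ s * ‖approxEval a (g.map (Int.castRingHom ℂ))‖),
      mul_self_lt_mul_self hG0 hcase]
  -- `|g| ≤ G₀`: Proposition (1.6) and Lemma (1.5)
  obtain ⟨P, hP⟩ : ∃ P : ℝ, P = ‖aeval α g‖ := ⟨_, rfl⟩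
  have hP0 : 0 ≤ P := by rw [hP]; exact norm_nonneg _
  have h16 := one_le_natDegree_mul_twoNorm_pow_mul_norm_aeval hh hα hα₁ hg
  rw [← hP] at h16
  -- `1 ≤ d · (uH)^d · G₀^{d-1} · P`
  have hhlen : twoNorm h ≤ u * H := by
    have h2 : twoNorm h ^ 2 ≤ (u * H) ^ 2 := by
      rw [mul_pow, hu2]
      exact twoNorm_sq_le_succ_mul_sq_of_supNorm_le hhd hH
    nlinarith [twoNorm_nonneg h, mul_nonneg (zero_le_one.trans hu1) (zero_le_one.trans hH1)]
  have huH1 : 1 ≤ u * H := one_le_mul_of_one_le_of_one_le hu1 hH1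
  have hstar : 1 ≤ (d : ℝ) * (u * H) ^ d * G ^ (d - 1) * P := by
    refine h16.trans ?_
    have e1 : (h.natDegree : ℝ) ≤ d := Nat.cast_le.mpr hhd
    have e2 : twoNorm h ^ g.natDegree ≤ (u * H) ^ d :=
      (pow_le_pow_left₀ (twoNorm_nonneg h) hhlen _).trans (pow_le_pow_right₀ huH1 hgd)
    have e3 : twoNorm g ^ (h.natDegree - 1) ≤ G ^ (d - 1) :=
      (pow_le_pow_left₀ (twoNorm_nonneg g) hcase _).trans
        (pow_le_pow_right₀ hG1 (Nat.sub_le_sub_right hhd 1))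
    refine mul_le_mul_of_nonneg_right ?_ hP0
    exact mul_le_mul (mul_le_mul e1 e2 (pow_nonneg (twoNorm_nonneg h) _) (Nat.cast_nonneg _))
      e3 (pow_nonneg (twoNorm_nonneg g) _)
      (mul_nonneg (Nat.cast_nonneg _) (pow_nonneg (zero_le_one.trans huH1) _))
  -- hence `G₀ · (d+1) ≤ 2^s · P`, using (1.12)
  obtain ⟨e, rfl⟩ : ∃ e, d = e + 1 := ⟨d - 1, by omega⟩
  rw [Nat.add_sub_cancel] at hstar
  have hmain : G * u ^ 2 ≤ (2 : ℝ) ^ s * P := by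
    calc G * u ^ 2 ≤ G * u ^ 2 * (((e + 1 : ℕ) : ℝ) * (u * H) ^ (e + 1) * G ^ e * P) :=
          le_mul_of_one_le_right (mul_nonneg hG0 (sq_nonneg u)) hstar
      _ = ((e + 1 : ℕ) : ℝ) * (u ^ (e + 3) * H ^ (e + 1) * G ^ (e + 1) * P) := by ring
      _ ≤ u ^ 2 * (u ^ (e + 3) * H ^ (e + 1) * G ^ (e + 1) * P) :=
          mul_le_mul_of_nonneg_right hdu
            (mul_nonneg (mul_nonneg (mul_nonneg (pow_nonneg (zero_le_one.trans hu1) _)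
              (pow_nonneg (zero_le_one.trans hH1) _)) (pow_nonneg hG0 _)) hP0)
      _ = t ^ ((e + 1) * (e + 1)) * u ^ (3 * (e + 1) + 4) * H ^ (2 * (e + 1)) * P := by
          rw [hG]
          ring
      _ ≤ (2 : ℝ) ^ s * P := by
          refine mul_le_mul_of_nonneg_right ?_ hP0
          rw [ht, hu, ← sq]
          exact hs
  -- Lemma (1.5): `2^s |g_ᾱ| ≥ 2^s |g(α)| - d |g|_∞ ≥ G₀ (d+1) - d G₀ = G₀`
  have h15 := norm_eval_sub_approxEval_le ha₀ ha (f := g.map (Int.castRingHom ℂ))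
    (by rw [natDegree_map_intCastRingHom_complex]; exact hgd)
  rw [eval_map_intCastRingHom_complex, supNorm_map_intCast] at h15
  have hsupG : g.supNorm ≤ G := (supNorm_le_twoNorm g).trans hcase
  have happ : G ≤ (2 : ℝ) ^ s * ‖approxEval a (g.map (Int.castRingHom ℂ))‖ := by
    have hrev := (norm_sub_norm_le _ _).trans h15
    rw [← hP] at hrev
    -- `2^s (P - |g_ᾱ|) ≤ d |g|_∞`
    have h2s : (0 : ℝ) < (2 : ℝ) ^ s := by positivity
    have hmul := mul_le_mul_of_nonneg_left hrev h2s.le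
    rw [show (2 : ℝ) ^ s * ((((2 : ℝ) ^ s)⁻¹) * ((e + 1 : ℕ) : ℝ) * g.supNorm) =
      ((e + 1 : ℕ) : ℝ) * g.supNorm by field_simp] at hmul
    have hdG : (((e + 1 : ℕ) : ℝ)) * g.supNorm ≤ ((e + 1 : ℕ) : ℝ) * G :=
      mul_le_mul_of_nonneg_left hsupG (by positivity)
    have hue : u ^ 2 = ((e + 1 : ℕ) : ℝ) + 1 := by rw [hu2]
    rw [hue] at hmain
    nlinarith
  have happ2 : G ^ 2 ≤ ((2 : ℝ) ^ s * ‖approxEval a (g.map (Int.castRingHom ℂ))‖) ^ 2 :=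
    pow_le_pow_left₀ hG0 happ 2
  nlinarith

/-! ### Theorem (1.15) -/

/-- **Theorem (1.15)**, (i) ⇔ (ii) and (ii) ⇔ (iii).  Hypotheses of Lemma (1.9) with (1.12);
`n ≤ d`; `v ∈ ℤ[X]` nonzero of degree at most `n` such that `|ṽ|² ≤ 2^n |x̃|²` for every nonzero
`x ∈ ℤ[X]` of degree at most `n` (the property of the first vector of a reduced basis of `L_s`
furnished by Theorem (1.1)).  Then (i) `|ṽ| ≤ 2^{d/2} · (d+1) · H` iff (ii) `v(α) = 0` iff
(iii) the degree of `α` is at most `n`. [cite: KannanLenstraLovasz1988, Theorem (1.15)] -/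
theorem minpolyLatticeNormSq_le_iff_aeval_eq_zero {α : ℂ} (hα₁ : ‖α‖ ≤ 1) {h : ℤ[X]}
    (hh : Irreducible h) (hα : aeval α h = 0) {d : ℕ} (hd : 1 ≤ d) (hhd : h.natDegree ≤ d)
    {H : ℝ} (hH : h.supNorm ≤ H) {a : ℕ → ℂ} {s : ℕ} (ha₀ : a 0 = 1)
    (ha : ∀ i, 1 ≤ i → i ≤ d → ‖α ^ i - a i‖ ≤ ((2 : ℝ) ^ s)⁻¹)
    (hs : √2 ^ (d ^ 2) * √(d + 1) ^ (3 * d + 4) * H ^ (2 * d) ≤ (2 : ℝ) ^ s)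
    {n : ℕ} (hnd : n ≤ d) {v : ℤ[X]} (hv0 : v ≠ 0) (hvn : v.natDegree ≤ n)
    (hred : ∀ x : ℤ[X], x ≠ 0 → x.natDegree ≤ n →
      minpolyLatticeNormSq s a v ≤ 2 ^ n * minpolyLatticeNormSq s a x) :
    (minpolyLatticeNormSq s a v ≤ (2 : ℝ) ^ d * ((d + 1) * H) ^ 2 ↔ aeval α v = 0) ∧
      (aeval α v = 0 ↔ h.natDegree ≤ n) := by
  have hn : h.natDegree ≠ 0 := natDegree_ne_zero_of_irreducible_of_aeval_eq_zero hh hα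
  -- (i) ⇒ (ii): Lemma (1.9) (1.11)
  have h12 : minpolyLatticeNormSq s a v ≤ (2 : ℝ) ^ d * ((d + 1) * H) ^ 2 → aeval α v = 0 := by
    intro hi
    by_contra hv
    exact not_le.mpr (lt_minpolyLatticeNormSq_of_aeval_ne_zero hα₁ hh hα hd hhd hH ha₀ ha hs
      (hvn.trans hnd) hv) hi
  -- (ii) ⇒ (iii): `h` divides `v` in `ℚ[X]`
  have h23 : aeval α v = 0 → h.natDegree ≤ n := by
    intro hv
    have hdvd := map_dvd_map_of_aeval_eq_zero hh hn hα hv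
    have hv0' : v.map (Int.castRingHom ℚ) ≠ 0 :=
      (Polynomial.map_eq_zero_iff (Int.castRingHom ℚ).injective_int).not.mpr hv0
    have := natDegree_le_of_dvd hdvd hv0'
    rw [natDegree_map_eq_of_injective (Int.castRingHom ℚ).injective_int,
      natDegree_map_eq_of_injective (Int.castRingHom ℚ).injective_int] at this
    exact this.trans hvn
  -- (iii) ⇒ (i): `h̃ ∈ L_s`, Lemma (1.9) (1.10) and the reducedness of `ṽ`
  have h31 : h.natDegree ≤ n → minpolyLatticeNormSq s a v ≤ (2 : ℝ) ^ d * ((d + 1) * H) ^ 2 := by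
    intro hiii
    have h110 := minpolyLatticeNormSq_minpoly_le hα hhd hH ha₀ ha
    have h2 : (2 : ℝ) ^ n ≤ 2 ^ d := pow_le_pow_right₀ one_le_two hnd
    calc minpolyLatticeNormSq s a v ≤ 2 ^ n * minpolyLatticeNormSq s a h := hred h hh.ne_zero hiii
      _ ≤ 2 ^ d * ((d + 1) * H) ^ 2 :=
          mul_le_mul h2 h110 (by rw [minpolyLatticeNormSq]; positivity) (by positivity)
  exact ⟨⟨h12, fun hii => h31 (h23 hii)⟩, ⟨h23, fun hiii => h12 (h31 hiii)⟩⟩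

/-- **Theorem (1.15)**, (ii) ⇔ (iii) separately: with `h` the minimal polynomial of `α` and
`v ≠ 0` of degree at most `n`, `v(α) = 0` iff `deg α ≤ n`.
[cite: KannanLenstraLovasz1988, Theorem (1.15) ((ii) ⇔ (iii))] -/
theorem aeval_eq_zero_iff_minpoly_natDegree_le_of_reduced {α : ℂ} (hα₁ : ‖α‖ ≤ 1) {h : ℤ[X]}
    (hh : Irreducible h) (hα : aeval α h = 0) {d : ℕ} (hd : 1 ≤ d) (hhd : h.natDegree ≤ d)
    {H : ℝ} (hH : h.supNorm ≤ H) {a : ℕ → ℂ} {s : ℕ} (ha₀ : a 0 = 1)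
    (ha : ∀ i, 1 ≤ i → i ≤ d → ‖α ^ i - a i‖ ≤ ((2 : ℝ) ^ s)⁻¹)
    (hs : √2 ^ (d ^ 2) * √(d + 1) ^ (3 * d + 4) * H ^ (2 * d) ≤ (2 : ℝ) ^ s)
    {n : ℕ} (hnd : n ≤ d) {v : ℤ[X]} (hv0 : v ≠ 0) (hvn : v.natDegree ≤ n)
    (hred : ∀ x : ℤ[X], x ≠ 0 → x.natDegree ≤ n →
      minpolyLatticeNormSq s a v ≤ 2 ^ n * minpolyLatticeNormSq s a x) :
    aeval α v = 0 ↔ h.natDegree ≤ n :=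
  (minpolyLatticeNormSq_le_iff_aeval_eq_zero hα₁ hh hα hd hhd hH ha₀ ha hs hnd hv0 hvn hred).2

/-- **Theorem (1.15)**, last clause: if moreover `n` equals the degree of `α` and `ṽ` belongs to
a basis of `L_s` (so that `v` is primitive), then `h = ±v`.
[cite: KannanLenstraLovasz1988, Theorem (1.15) (h = ±v)] -/
theorem eq_minpoly_or_eq_neg_of_reduced_of_isPrimitive {α : ℂ} (hα₁ : ‖α‖ ≤ 1) {h : ℤ[X]}
    (hh : Irreducible h) (hα : aeval α h = 0) {d : ℕ} (hd : 1 ≤ d) (hhd : h.natDegree ≤ d)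
    {H : ℝ} (hH : h.supNorm ≤ H) {a : ℕ → ℂ} {s : ℕ} (ha₀ : a 0 = 1)
    (ha : ∀ i, 1 ≤ i → i ≤ d → ‖α ^ i - a i‖ ≤ ((2 : ℝ) ^ s)⁻¹)
    (hs : √2 ^ (d ^ 2) * √(d + 1) ^ (3 * d + 4) * H ^ (2 * d) ≤ (2 : ℝ) ^ s)
    {n : ℕ} (hnd : n ≤ d) {v : ℤ[X]} (hv0 : v ≠ 0) (hvn : v.natDegree ≤ n)
    (hred : ∀ x : ℤ[X], x ≠ 0 → x.natDegree ≤ n →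
      minpolyLatticeNormSq s a v ≤ 2 ^ n * minpolyLatticeNormSq s a x)
    (hdeg : h.natDegree = n) (hprim : v.IsPrimitive) : v = h ∨ v = -h := by
  have hn : h.natDegree ≠ 0 := natDegree_ne_zero_of_irreducible_of_aeval_eq_zero hh hα
  have hii : aeval α v = 0 :=
    (aeval_eq_zero_iff_minpoly_natDegree_le_of_reduced hα₁ hh hα hd hhd hH ha₀ ha hs hnd hv0 hvn
      hred).mpr hdeg.le
  -- `h ∣ v` in `ℤ[X]` (Gauss), and `deg v ≤ deg h`: `v = c · h` with `c ∈ ℤ`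
  have hdvd : h ∣ v := (IsPrimitive.Int.dvd_iff_map_cast_dvd_map_cast h v (hh.isPrimitive hn)).mpr
    (map_dvd_map_of_aeval_eq_zero hh hn hα hii)
  obtain ⟨q, hq⟩ := hdvd
  have hq0 : q ≠ 0 := by
    rintro rfl
    exact hv0 (by rw [hq, mul_zero])
  have hqdeg : q.natDegree = 0 := by
    have := natDegree_mul hh.ne_zero hq0
    rw [← hq] at this
    omega
  obtain ⟨c, hc⟩ : ∃ c, q = C c := ⟨_, eq_C_of_natDegree_eq_zero hqdeg⟩
  -- `v` primitive: `c = ±1`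
  have hunit : IsUnit c := hprim c ⟨h, by rw [hq, hc, mul_comm]⟩
  rcases Int.isUnit_iff.mp hunit with rfl | rfl
  · left
    rw [hq, hc, C_1, mul_one]
  · right
    rw [hq, hc, C_neg, C_1, mul_neg, mul_one]

end Literature.NumberTheory.DiophantineApproximation.MinimalPolynomialRecovery

end
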